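import Summits.BirchSwinnertonDyer.BirchSwinnertonDyer.Theorems.GenusKolyvaginAtTwoGenusPrimitiveSupplyAtTwoTwistSelmerTransferUpRat
import Summits.BirchSwinnertonDyer.BirchSwinnertonDyer.Theorems.GenusKolyvaginAtTwoGenusPrimitiveSupplyAtTwoTwistingPrime
import Summits.BirchSwinnertonDyer.BirchSwinnertonDyer.Theorems.GenusKolyvaginAtTwoGenusPrimitiveSupplyAtTwoDualityDischarged
import Summits.BirchSwinnertonDyer.BirchSwinnertonDyer.Theorems.ByReductionTypeAtTwoRankOneAtTwoOneDoorLawDefs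
import Summits.BirchSwinnertonDyer.Rank1Residual.F1Sign2.EggLemmaAtTwoProofs
import Summits.BirchSwinnertonDyer.BirchSwinnertonDyer.Theorems.GenusKolyvaginAtTwoKramerParityHolds
import Literature.NumberTheory.EllipticCurves.TwoAdicImageQuadraticTwistProofs
import Literature.NumberTheory.EllipticCurves.ExceptionalPrimesDensityModels
import Literature.NumberTheory.EllipticCurves.GlobalMinimalModelProofs
import Literature.NumberTheory.EllipticCurves.TwistFamilySelmerGroupCardInvarianceProofs
import HarnessLib

/-!
# Route `GenusKolyvaginAtTwo`, crux #2 `GenusPrimitiveSupplyAtTwo` (stmt-BirchSwinnertonDyer-22136):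
# THE DOOR SUPPLY AT `Δ < 0` FOR EVERY ODD `2`-SELMER DIMENSION — Mazur–Rubin's rank-lowering, ITERATED prime Heegner twins
# (`Ш(W)[2] ≠ 0` allowed: `#Sel₂(W) = 2^k`, `k` odd ⟹ a door-admissible Heegner field with `Sel₂(W^{(d_K)}) = 0`)

Width seat `bsd-line-gk2-p4` g15 (cell `bsd-f1-sign2`), companion of `…DoorSupplySlice` (the three doors on `{Ш[2] = 0, Δ ∉ ℚ²}`). THEOREMS ONLY
(no definition, no named fact, no `sorry`); helper `--supports stmt-BirchSwinnertonDyer-22136`; no item is closed; BSD is not proved by any of this.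

WHY. `RankOneAtTwoOneDoor.DoorSupplyAtTwo` (fkl line, AN-27 supply: «THEOREM on paper, MR 3.3/3.5 iterated») asks, WITHOUT `Ш(W)[2] = 0`, for an imaginary
quadratic `K` with `d_K` door-admissible and `Sel₂(W^{(d_K)}) = 0`. At `Δ_W < 0` one transposition prime lowers `dim Sel₂` by exactly one when `Sel₂` is
not strict there (Mazur–Rubin Cor. 3.4 (i), in the tree as gk2-p5's `GenusKolyTwin.cor34i_twin_prime_heegner_of_duality_of_parity`, its three print inputs
{Poitou–Tate, Tate χ, Kramer parity} now tree theorems), such primes exist beyond every bound in every residue class `−1 mod m` (this lineage's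
`GenusKolyTwistingPrime.exists_twistingPrime_not_selmerGroup_le_strictLocalKer`), the twin again has `Δ < 0` and big image — so the process ITERATES:

* §44 `smul_quadraticTwist_eq_variableChange_quadraticTwist` — twisting commutes with a change of variables up to the change `(u, e r, 0, 0)`;
  `hasSurjectiveModNGaloisRep_two_of_smul_quadraticTwist_eq`, `Δ_neg_of_smul_quadraticTwist_eq` — big image and `Δ < 0` pass to every model of a twist.
* §45 **`exists_twist_natCard_selmerGroup_eq_one_of_negDisc`** — the induction: `V` globally minimal, `Δ_V < 0`, `ρ̄_{V,2}` onto, `#Sel₂(V) = 2^k`, any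
  `M ≠ 0`, any bound `b` ⟹ a squarefree `d ≡ 1 (mod 8M)` whose prime factors are `> b` and prime to `M`, of sign `(−1)^k`, and an elliptic model
  `Vd ≅ V^{(d)}` with `#Sel₂(Vd) = 1` (`d = ∏ (−ℓ_i)` over `k` successive twisting primes; `(V^{d})^{d'} = V^{dd'}` on the nose, `quadraticTwist_quadraticTwist`).
* §46 **`exists_doorAdmissible_twistSelmerTwoCard_eq_one_of_negDisc`** — `W` globally minimal, `Δ_W < 0`, `E(ℚ)[2] = 0`, `#Sel₂(W) = 2^k` with `k` ODD
  (e.g. rank `1` and `dim Ш(W)[2]` even): an imaginary quadratic `K` (`Quadratic.exists_numberField_discr_eq`) with `d_K` door-admissible,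
  `#Sel₂(W^{(d_K)}) = 1`, `(d_K, N_W) = 1` and the Heegner hypothesis (`d_K ≡ 1 (mod 8N_W)`: every prime of `2N_W` splits).

Honest framing: KNOWN in print (Mazur–Rubin 2010 Prop. 3.3 / Cor. 3.4 / Lemma 3.5, the proof of Thm. 1.4 at `Δ < 0`); kernel-new assembly;
beyond-print theorem: no. The `Δ > 0` half (even `t`, the real place in `T`) and the parity-free form of `DoorSupplyAtTwo` are NOT claimed.
Crux 22136 stays OPEN at (U) 24947 ∧ (CONV₂) 19220/24948.

References: [MazurRubin2010] Prop. 3.3, Cor. 3.4 (i), Lemma 3.5, Thm. 1.4; [Kramer1981] Thm. 1, Prop. 3; [GrossLMS1991] §1 (p. 235);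
[SilvermanAEC2009] III.1, VIII.8 Cor. 8.3, X.4.2.
-/

set_option linter.dupNamespace false -- tree convention: `Summit.BirchSwinnertonDyer.BirchSwinnertonDyer.Theorems` (summit = sub-problem)
set_option autoImplicit false

noncomputable section

open scoped Classical

namespace Summit.BirchSwinnertonDyer.BirchSwinnertonDyer.Theorems.GenusKolyTransp

open WeierstrassCurve Field NumberField IsDedekindDomain Function
open Literature.NumberTheory.EllipticCurves Literature.NumberTheory.GaloisRepresentations Literature.NumberTheory
open Literature.NumberTheory.QuadraticFields (Quadratic.exists_numberField_discr_eq Quadratic.isTotallyComplex_of_discr_neg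
  Quadratic.ncard_primesOver_eq_two_iff_jacobiSym Quadratic.ncard_primesOver_two_eq_two_iff)
open Summit.BirchSwinnertonDyer.Rank1Residual.F1Sign2
open Summit.BirchSwinnertonDyer.Rank1Residual.F1Sign2.EggDoubling (eq_zero_of_two_smul_eq_zero)
open Summit.BirchSwinnertonDyer.BirchSwinnertonDyer.Theorems.RankOneAtTwoOneDoor (DoorAdmissible)
open Summit.BirchSwinnertonDyer.BirchSwinnertonDyer.Theorems.GenusKolyTwin (exists_heegnerField_of_prime cor34i_twin_prime_heegner_of_duality_of_parity)
open Summit.BirchSwinnertonDyer.BirchSwinnertonDyer.Theorems.GenusKolyTwistingPrime (exists_twistingPrime_not_selmerGroup_le_strictLocalKer)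
open Summit.BirchSwinnertonDyer.BirchSwinnertonDyer.Theorems.SchneiderFreeAdditiveX3.PoitouTateReduction (poitouTate_selmerStructure_duality_real_holds)

/-! ## §44 Models of twists: change of variables, big image, sign of the discriminant -/

section ModelsRat

/-- **Twisting commutes with a change of variables** (over `ℚ`): `(C • X)^{(e)} = (u, e r, 0, 0) • X^{(e)}` in the tree's model of the quadratic
twist (`y² = x³ + e b₂/4 x² + e² b₄/2 x + e³ b₆/4`): the `b`-invariants of `C • X` are `u⁻²(b₂ + 12r)`, `u⁻⁴(b₄ + r b₂ + 6r²)`,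
`u⁻⁶(b₆ + 2 r b₄ + r² b₂ + 4r³)`. [cite: SilvermanAEC2009, III.1 (Table 3.1)] -/
theorem smul_quadraticTwist_eq_variableChange_quadraticTwist (X : WeierstrassCurve ℚ) (C : VariableChange ℚ) (e : ℚ) :
    (⟨C.u, e * C.r, 0, 0⟩ : VariableChange ℚ) • X.quadraticTwist e = (C • X).quadraticTwist e := by
  ext
  · simp only [variableChange_a₁, quadraticTwist_a₁]
    ring
  · simp only [variableChange_a₂, quadraticTwist_a₁, quadraticTwist_a₂, variableChange_b₂]
    ring
  · simp only [variableChange_a₃, quadraticTwist_a₁, quadraticTwist_a₃]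
    ring
  · simp only [variableChange_a₄, quadraticTwist_a₁, quadraticTwist_a₂, quadraticTwist_a₃, quadraticTwist_a₄, variableChange_b₄]
    ring
  · simp only [variableChange_a₆, quadraticTwist_a₁, quadraticTwist_a₂, quadraticTwist_a₃, quadraticTwist_a₄, quadraticTwist_a₆,
      variableChange_b₆]
    ring

variable (V : WeierstrassCurve ℚ) [V.IsElliptic]

/-- **Big image passes to every model of a twist**: `ρ̄_{Vd,2}` onto for `C • V^{(d)} = Vd`, `d ≠ 0` (Dokchitser–Dokchitser's criterion is
twist-invariant, `hasSurjectiveModNGaloisRep_two_quadraticTwist_iff`, and model-invariant, `hasSurjectiveModNGaloisRep_smul`).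
[cite: DokchitserDokchitserMathZ2012, Theorem (1)] -/
theorem hasSurjectiveModNGaloisRep_two_of_smul_quadraticTwist_eq (hsurj : V.HasSurjectiveModNGaloisRep 2) {d : ℚ} (hd : d ≠ 0)
    {Vd : WeierstrassCurve ℚ} {C : VariableChange ℚ} (hC : C • V.quadraticTwist d = Vd) : Vd.HasSurjectiveModNGaloisRep 2 := by
  rw [← hC]
  exact hasSurjectiveModNGaloisRep_smul _ C 2 ((hasSurjectiveModNGaloisRep_two_quadraticTwist_iff V hd).mpr hsurj)

omit [V.IsElliptic] in
/-- **`Δ < 0` passes to every model of a twist**: `Δ(C • V^{(d)}) = u⁻¹² d⁶ Δ(V)`. [cite: SilvermanAEC2009, III.1 (Table 3.1)] -/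
theorem Δ_neg_of_smul_quadraticTwist_eq (hΔ : V.Δ < 0) {d : ℚ} (hd : d ≠ 0) {Vd : WeierstrassCurve ℚ} {C : VariableChange ℚ}
    (hC : C • V.quadraticTwist d = Vd) : Vd.Δ < 0 := by
  rw [← hC, variableChange_Δ, quadraticTwist_Δ]
  have hu : (0 : ℚ) < (C.u⁻¹ : ℚˣ) ^ 12 := Even.pow_pos (by decide) (Units.ne_zero _)
  have hd6 : (0 : ℚ) < d ^ 6 := Even.pow_pos (by decide) hd
  have h := mul_pos hu hd6
  nlinarith

end ModelsRat

/-! ## §45 The iteration: `k` twisting primes kill a `2`-Selmer group of order `2^k` at `Δ < 0` -/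

/-- **`k` successive prime Heegner twins kill `Sel₂` of order `2^k` at `Δ < 0`** (Mazur–Rubin's rank-lowering iterated). `V/ℚ` globally minimal
elliptic, `Δ_V < 0`, `ρ̄_{V,2}` onto, `#Sel₂(V) = 2^k`; for every `M ≠ 0` and bound `b` there are a squarefree `d ≡ 1 (mod 8M)` all of whose prime
factors are `> b` and prime to `M`, with `d > 0` for even `k` and `d < 0` for odd `k`, and an elliptic `Vd` with `C • V^{(d)} = Vd` and `#Sel₂(Vd) = 1`.
Step: a twisting prime `ℓ ≡ −1 (mod 8 M N_V)` at which `Sel₂(V)` is not strict (`exists_twistingPrime_not_selmerGroup_le_strictLocalKer`), its Heegner field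
`ℚ(√−ℓ)` for `N_V` (`exists_heegnerField_of_prime`), a globally minimal twin `Wd ≅ V^{(−ℓ)}` (`hasGlobalMinimalModel_rat_holds`) with
`#Sel₂(V) = 2·#Sel₂(Wd)` (`cor34i_twin_prime_heegner_of_duality_of_parity`, inputs `poitouTate_selmerStructure_duality_real_holds`, `GenusKolyLowering.localEP`,
`GenusKolyPR.kramerParity_holds`), then the induction hypothesis for `Wd` with modulus `M ℓ`; `V^{(−ℓ d')} = (V^{(−ℓ)})^{(d')}`.
[cite: MazurRubin2010, Prop. 3.3, Cor. 3.4 (i), Lemma 3.5 and the proof of Thm. 1.4] [cite: Kramer1981, Prop. 3] -/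
theorem exists_twist_natCard_selmerGroup_eq_one_of_negDisc :
    ∀ (k : ℕ) (V : WeierstrassCurve ℚ) [V.IsElliptic] [V.IsGloballyMinimal], V.Δ < 0 → V.HasSurjectiveModNGaloisRep 2 →
      Nat.card (V.selmerGroup 2) = 2 ^ k → ∀ (M : ℕ), M ≠ 0 → ∀ (b : ℕ),
      ∃ (d : ℤ) (Vd : WeierstrassCurve ℚ) (_ : Vd.IsElliptic),
        (∃ C : VariableChange ℚ, C • V.quadraticTwist (d : ℚ) = Vd) ∧ Nat.card (Vd.selmerGroup 2) = 1 ∧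
        Squarefree d ∧ d ≡ 1 [ZMOD 8 * M] ∧ (∀ q : ℕ, q.Prime → (q : ℤ) ∣ d → b < q ∧ ¬ q ∣ M) ∧
        (Even k → 0 < d) ∧ (Odd k → d < 0) := by
  intro k
  induction k with
  | zero =>
    intro V _ _ hΔ hsurj hcard M hM b
    haveI : NeZero (2 : ℚ) := ⟨two_ne_zero⟩
    obtain ⟨C, hC⟩ := V.exists_variableChange_quadraticTwist_one
    refine ⟨1, V, inferInstance, ⟨C⁻¹, ?_⟩, by rw [pow_zero] at hcard; exact hcard, squarefree_one, Int.ModEq.refl _,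
      fun q hq hqd ↦ ?_, fun _ ↦ one_pos, fun h ↦ ?_⟩
    · rw [Int.cast_one, ← hC, inv_smul_smul]
    · exfalso
      have h1 : (q : ℤ) ∣ 1 := hqd
      have := Int.eq_one_of_dvd_one (by positivity) h1
      exact hq.one_lt.ne' (by exact_mod_cast this)
    · exact absurd h (by decide)
  | succ k ih =>
    intro V _ _ hΔ hsurj hcard M hM b
    haveI : Fact (Nat.Prime 2) := ⟨Nat.prime_two⟩
    have hNV : V.conductorNorm ℤ ≠ 0 := (V.conductorNorm_pos_holds).ne'
    have hSel : Nat.card (V.selmerGroup 2) ≠ 1 := by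
      rw [hcard, pow_succ]
      have : 0 < 2 ^ k := pow_pos two_pos k
      omega
    -- ### the twisting prime `ℓ ≡ −1 (mod 8 M N_V)`, not strict for `Sel₂(V)`
    have hN : 8 * M * V.conductorNorm ℤ ≠ 0 := mul_ne_zero (mul_ne_zero (by norm_num) hM) hNV
    obtain ⟨ℓ, hℓF, hbℓ, hℓ2N, hℓ8, hℓdvd, hns⟩ := exists_twistingPrime_not_selmerGroup_le_strictLocalKer V hsurj hΔ hSel hN b
    have hℓ : ℓ.Prime := hℓF.out
    have hℓsucc : 8 * M * V.conductorNorm ℤ ∣ ℓ + 1 := hℓdvd _ dvd_rfl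
    have hℓM : ¬ ℓ ∣ M := fun h ↦ hℓ2N (Dvd.dvd.mul_left (Dvd.dvd.mul_right (Dvd.dvd.mul_left h 8) _) 2)
    have hℓN' : ∀ p : ℕ, p.Prime → p ∣ V.conductorNorm ℤ → p ≠ 2 → (ℓ : ZMod p) = -1 := by
      intro p _ hp _
      have hp' : p ∣ ℓ + 1 := (Dvd.dvd.mul_left hp (8 * M)).trans hℓsucc
      have h : ((ℓ + 1 : ℕ) : ZMod p) = 0 := (ZMod.natCast_eq_zero_iff _ _).mpr hp'
      rw [Nat.cast_add, Nat.cast_one] at h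
      exact eq_neg_of_add_eq_zero_left h
    -- ### the Heegner field `ℚ(√−ℓ)` of `V` and a globally minimal twin
    obtain ⟨-, -, K, _, _, hK, hdK, hodd, -, hH, h2K, -, -⟩ := exists_heegnerField_of_prime V hℓ hℓ8 hℓN'
    have hdK0 : ((NumberField.discr K : ℤ) : ℚ) ≠ 0 := by
      rw [hdK]; push_cast; exact neg_ne_zero.mpr (by exact_mod_cast hℓ.ne_zero)
    haveI := V.isElliptic_quadraticTwist hdK0
    obtain ⟨C₁, hC₁⟩ := hasGlobalMinimalModel_rat_holds (V.quadraticTwist ((NumberField.discr K : ℤ) : ℚ))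
    haveI := hC₁
    have hWd : ∃ C : VariableChange ℚ, C • V.quadraticTwist ((NumberField.discr K : ℤ) : ℚ) = C₁ • V.quadraticTwist ((NumberField.discr K : ℤ) : ℚ) :=
      ⟨C₁, rfl⟩
    -- ### halving
    have hhalf := (cor34i_twin_prime_heegner_of_duality_of_parity V (poitouTate_selmerStructure_duality_real_holds (K := ℚ))
      (GenusKolyLowering.localEP ℚ) GenusKolyPR.kramerParity_holds hsurj hΔ hK hodd hH h2K hdK
      (C₁ • V.quadraticTwist ((NumberField.discr K : ℤ) : ℚ)) hWd).2 hns
    have hcard' : Nat.card ((C₁ • V.quadraticTwist ((NumberField.discr K : ℤ) : ℚ)).selmerGroup 2) = 2 ^ k := by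
      rw [hcard, pow_succ] at hhalf
      omega
    -- ### the twin has `Δ < 0` and big image; induction
    have hΔ' := Δ_neg_of_smul_quadraticTwist_eq V hΔ hdK0 (C := C₁) rfl
    have hsurj' := hasSurjectiveModNGaloisRep_two_of_smul_quadraticTwist_eq V hsurj hdK0 (C := C₁) rfl
    have hMℓ : M * ℓ ≠ 0 := mul_ne_zero hM hℓ.ne_zero
    obtain ⟨d', Vd', _, ⟨C', hC'⟩, hcard1, hsf', hmod', hprimes', heven', hodd'⟩ :=
      ih (C₁ • V.quadraticTwist ((NumberField.discr K : ℤ) : ℚ)) hΔ' hsurj' hcard' (M * ℓ) hMℓ b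
    -- ### the product twist `d = −ℓ d'`
    refine ⟨-(ℓ : ℤ) * d', Vd', inferInstance, ⟨C' * (⟨C₁.u, (d' : ℚ) * C₁.r, 0, 0⟩ : VariableChange ℚ), ?_⟩, hcard1, ?_, ?_,
      fun q hq hqd ↦ ?_, fun hk ↦ ?_, fun hk ↦ ?_⟩
    · -- the model: `V^{(−ℓ d')} = (V^{(−ℓ)})^{(d')}`, and `(u, d' r, 0, 0) • (V^{(−ℓ)})^{(d')} = (C₁ • V^{(−ℓ)})^{(d')}`
      have hdK' : ((NumberField.discr K : ℤ) : ℚ) = -(ℓ : ℚ) := by rw [hdK]; push_cast; ring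
      rw [mul_smul, show (((-(ℓ : ℤ) * d' : ℤ)) : ℚ) = -(ℓ : ℚ) * (d' : ℚ) by push_cast; ring, ← quadraticTwist_quadraticTwist, ← hdK',
        smul_quadraticTwist_eq_variableChange_quadraticTwist, hC']
    · -- squarefree
      have hℓd' : ¬ (ℓ : ℤ) ∣ d' := fun h ↦ (hprimes' ℓ hℓ h).2 (dvd_mul_left ℓ M)
      rw [← Int.squarefree_natAbs, Int.natAbs_mul, Int.natAbs_neg, Int.natAbs_natCast,
        Nat.squarefree_mul ((Nat.Prime.coprime_iff_not_dvd hℓ).mpr (fun h ↦ hℓd' (Int.natCast_dvd.mpr h)))]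
      exact ⟨hℓ.squarefree, Int.squarefree_natAbs.mpr hsf'⟩
    · -- `d ≡ 1 (mod 8M)`: `−ℓ ≡ 1` and `d' ≡ 1`
      have h1 : -(ℓ : ℤ) ≡ 1 [ZMOD 8 * M] := by
        have h8M : ((8 * M : ℕ) : ℤ) ∣ (ℓ : ℤ) + 1 := by exact_mod_cast (Dvd.intro _ rfl : 8 * M ∣ 8 * M * V.conductorNorm ℤ).trans hℓsucc
        rw [Int.modEq_iff_dvd]
        have : (1 : ℤ) - -(ℓ : ℤ) = ℓ + 1 := by ring
        rw [this]; exact_mod_cast h8M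
      have h2 : d' ≡ 1 [ZMOD 8 * M] := by
        have h : d' ≡ 1 [ZMOD 8 * (M : ℤ) * (ℓ : ℤ)] := by
          rw [show (8 * (M : ℤ)) * (ℓ : ℤ) = 8 * ((M * ℓ : ℕ) : ℤ) by push_cast; ring]; exact hmod'
        exact Int.ModEq.of_mul_right _ h
      simpa using h1.mul h2
    · -- prime factors
      rw [neg_mul, dvd_neg] at hqd
      have hq' : q ∣ ℓ * d'.natAbs := by
        have := Int.natCast_dvd.mp hqd
        rwa [Int.natAbs_mul, Int.natAbs_natCast] at this
      rcases (Nat.Prime.dvd_mul hq).mp hq' with h | h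
      · have hqℓ : q = ℓ := (Nat.prime_dvd_prime_iff_eq hq hℓ).mp h
        subst hqℓ
        exact ⟨hbℓ, hℓM⟩
      · obtain ⟨hb, hqM⟩ := hprimes' q hq (Int.natCast_dvd.mpr h)
        exact ⟨hb, fun h' ↦ hqM (Dvd.dvd.mul_right h' ℓ)⟩
    · -- `k + 1` even: `k` odd, `d' < 0`
      have hk' : Odd k := Nat.not_even_iff_odd.mp (Nat.even_add_one.mp hk)
      have := hodd' hk'
      have hℓpos : (0 : ℤ) < ℓ := by exact_mod_cast hℓ.pos
      nlinarith
    · -- `k + 1` odd: `k` even, `d' > 0`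
      have hk' : Even k := Nat.not_odd_iff_even.mp (Nat.odd_add_one.mp hk)
      have := heven' hk'
      have hℓpos : (0 : ℤ) < ℓ := by exact_mod_cast hℓ.pos
      nlinarith

/-! ## §46 The door supply at `Δ < 0` for every odd `2`-Selmer dimension -/

/-- **THE DOOR SUPPLY AT `Δ < 0` FOR EVERY ODD `2`-SELMER DIMENSION.** `W/ℚ` globally minimal elliptic, `Δ_W < 0`, `E(ℚ)[2] = 0` (so `ρ̄_{W,2}` is onto),
`#Sel₂(W) = 2^k` with `k` odd (`k = 1`: `Ш[2] = 0` — the g13/g14 door; `k ≥ 3`: `Ш(W)[2] ≠ 0` allowed): there is an imaginary quadratic `K` with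
`d_K` door-admissible (all its primes good; `d_K ≡ 1 (mod 8N_W)`), `#Sel₂(W^{(d_K)}) = 1`, `(d_K, N_W) = 1` and the Heegner hypothesis for `N_W` —
the conclusion of `RankOneAtTwoOneDoor.DoorSupplyAtTwo` on `{Δ < 0, dim Sel₂ odd}`. [cite: MazurRubin2010, Prop. 3.3, Cor. 3.4 (i), Lemma 3.5, Thm. 1.4]
[cite: Kramer1981, Prop. 3] [cite: GrossLMS1991, §1 (p. 235)] -/
theorem exists_doorAdmissible_twistSelmerTwoCard_eq_one_of_negDisc (W : WeierstrassCurve ℚ) [W.IsElliptic] [W.IsGloballyMinimal]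
    [NeZero (W.conductorNorm ℤ)] (hΔ : W.Δ < 0) (hT : NoRationalTwoTorsion W) {k : ℕ} (hk : Nat.card (W.selmerGroup 2) = 2 ^ k)
    (hodd : Odd k) :
    ∃ (K : Type) (_ : Field K) (_ : NumberField K),
      IsImaginaryQuadratic K ∧ DoorAdmissible W (NumberField.discr K) ∧ twistSelmerTwoCard W (NumberField.discr K) = 1 ∧
      Nat.Coprime (NumberField.discr K).natAbs (W.conductorNorm ℤ) ∧ SatisfiesHeegnerHypothesis (W.conductorNorm ℤ) K := by
  have hN : W.conductorNorm ℤ ≠ 0 := (W.conductorNorm_pos_holds).ne'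
  -- `ρ̄_{W,2}` onto
  have hsurj : W.HasSurjectiveModNGaloisRep 2 := by
    refine (hasSurjectiveModNGaloisRep_two_iff W).mpr ⟨fun P hP ↦ ?_, fun ⟨r, hr⟩ ↦ ?_⟩
    · have h := eq_zero_of_two_smul_eq_zero W hT P
      convert h (by convert hP)
    · exact absurd hΔ (not_lt.mpr (hr ▸ mul_self_nonneg r))
  obtain ⟨d, Vd, _, ⟨C, hC⟩, hcard1, hsf, hmod, hprimes, -, hneg⟩ :=
    exists_twist_natCard_selmerGroup_eq_one_of_negDisc k W hΔ hsurj hk (W.conductorNorm ℤ) hN 2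
  have hdneg : d < 0 := hneg hodd
  have hmodN : ∀ n : ℤ, n ∣ ((8 * W.conductorNorm ℤ : ℕ) : ℤ) → d % n = 1 % n := fun n hn ↦ Int.ModEq.of_dvd hn hmod
  have hd8 : d % 8 = 1 := by
    have := hmodN 8 ⟨W.conductorNorm ℤ, by push_cast; ring⟩
    omega
  have hjacN : ∀ p : ℕ, p.Prime → p ≠ 2 → p ∣ W.conductorNorm ℤ → jacobiSym d p = 1 := fun p hp hp2 hpN ↦ by
    rw [jacobiSym.mod_left, hmodN p (by exact_mod_cast Dvd.dvd.mul_left hpN 8), ← jacobiSym.mod_left]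
    exact jacobiSym.one_left p
  -- the field `K = ℚ(√d)`
  have hD : (d % 4 = 1 ∧ Squarefree d ∧ d ≠ 1) ∨ (4 ∣ d ∧ (d / 4 % 4 = 2 ∨ d / 4 % 4 = 3) ∧ Squarefree (d / 4)) :=
    Or.inl ⟨by omega, hsf, by omega⟩
  obtain ⟨K, _, _, h2K, hdisc⟩ := Quadratic.exists_numberField_discr_eq hD
  have hK : IsImaginaryQuadratic K := ⟨h2K, Quadratic.isTotallyComplex_of_discr_neg h2K (by rw [hdisc]; exact hdneg)⟩
  have hH : SatisfiesHeegnerHypothesis (W.conductorNorm ℤ) K := by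
    intro p hp hpN
    by_cases hp2 : p = 2
    · subst hp2
      have h := (Quadratic.ncard_primesOver_two_eq_two_iff h2K).mpr (by rw [hdisc]; exact hd8)
      exact_mod_cast h
    · exact (Quadratic.ncard_primesOver_eq_two_iff_jacobiSym h2K hp hp2).mpr (by rw [hdisc]; exact hjacN p hp hp2 hpN)
  have hcop : Nat.Coprime (NumberField.discr K).natAbs (W.conductorNorm ℤ) := by
    rw [hdisc]
    refine Nat.coprime_of_dvd fun q hq hqd hqN ↦ ?_
    exact (hprimes q hq (Int.natCast_dvd.mpr hqd)).2 hqN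
  have hadm : DoorAdmissible W d := by
    refine ⟨hdneg, hsf, hd8, fun q hq hqd _ ↦ ?_, fun ℓ hℓ hℓ2 hbad ↦ ?_⟩
    · by_contra hng
      exact (hprimes q hq hqd).2 ((W.dvd_conductorNorm_iff_not_hasGoodReductionAtPrime q).mpr hng)
    · haveI := Fact.mk hℓ
      exact hjacN ℓ hℓ hℓ2 ((W.dvd_conductorNorm_iff_not_hasGoodReductionAtPrime ℓ).mpr (hbad inferInstance))
  have hcard : twistSelmerTwoCard W d = 1 := by
    haveI := W.isElliptic_quadraticTwist (d := ((d : ℤ) : ℚ)) (by exact_mod_cast hdneg.ne)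
    have h := natCard_selmerGroup_smul (W.quadraticTwist ((d : ℤ) : ℚ)) C (n := 2) two_ne_zero
    rw [hC] at h
    simp only [Nat.cast_ofNat] at h
    unfold twistSelmerTwoCard
    rw [← h, hcard1]
  refine ⟨K, inferInstance, inferInstance, hK, ?_, ?_, hcop, hH⟩
  · rw [hdisc]; exact hadm
  · rw [hdisc]; exact hcard

end Summit.BirchSwinnertonDyer.BirchSwinnertonDyer.Theorems.GenusKolyTransp

end
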